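import Summits.BirchSwinnertonDyer.BirchSwinnertonDyer.Theorems.KolyvaginDepthDoorDepthTableRankTwo563a1TwistBSDQuotient
import Summits.BirchSwinnertonDyer.BirchSwinnertonDyer.Theorems.KolyvaginDepthDoorDepthTableSteinWuthrichEvenRankBSDQuotientESided
import Summits.BirchSwinnertonDyer.BirchSwinnertonDyer.Theorems.KolyvaginDepthDoorDepthTableRowsExactReading944e1
import HarnessLib

/-!
# Route `KolyvaginDepthDoor`, crux `KolyvaginDepthSupplyKN` (stmt-BirchSwinnertonDyer-22820) —
# DEPTH TABLE v15, the even-rank row `563a1` UNIFORM IN THE PRIME with `E`-SIDED hypotheses: the crux at `563a1` from ONE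
# BSD-quotient valuation of the Heegner twist `E^{(-8)}` at ANY admissible `p < 1000` (tolerance `ord_p ≤ 1`)

Helper file of the lead prover of line `levelone` (kdd-p1 g19; `--supports stmt-BirchSwinnertonDyer-22820
--as helper`); it closes nothing and BSD is NOT proved by it.

As g17's `…Uniform389a1` / g19's `…RankTwo389a1TwistBSDQuotientUniform`, for `E = 563a1` (`N = 563`, `|Δ_min| = 563`, semistable) and
its Heegner field of record `d_K = -8`: every side condition of the row is uniform in the admissible prime `p` — Kodaira–Néron and ♠ (1)
(exponents `< 5`), ♠ (2) (semistable), `p ∤ d_K`; the `p`-dependent inputs on `E` (good ordinary, `ρ_{E,p^n}` onto) are hypotheses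
(kernel-certified in the tree at the prime of record). On the twist side NOTHING `p`-dependent is assumed: for the g19 minimal model
`T₀ = [0, -1, 0, -961, -11167]` (`Δ(T₀) = 2^18 · 563`) surjectivity, good reduction and ordinarity at `p` follow from `E`'s (generic
`hasSurjectiveModNGaloisRep_of_smul_eq_quadraticTwist`, `goodOrdinary_of_smul_eq_quadraticTwist` — the tree's PROVED twisting formula
`a_p(T) = (d_K/p)·a_p(E)`), and Kodaira–Néron of `T₀` holds at every `p ≥ 5` (`minTwist8_kodairaNeron_of_five_le`).

* `kodairaNeron_of_five_le`, `spadeOne_of_five_le`, `sha_inf_torsionBy_eq_bot_at`, `cruxBody_of_twistSelmer_at` — the `E`-side row of `563a1`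
  uniform in `p` (g17's pattern: SW Thm. 1.1 at any `5 ≤ p < 1000` + the generic `cruxBody_of_sha_of_twistSelmer_of_lemma84`, `#Sel_p ≤ p²`).
* `cruxBody_of_twistBSDQuotient_at` — **for every admissible `p` and ONE `K` with `d_K = -8`: IF `ord_{s=1} L(T₀,s) = 1` and
  `ord_p(L'(T₀,1)/(Ω·Reg)) ≤ 1`, THEN the clause of `KolyvaginDepthSupplyKN` holds at `563a1` VERBATIM** (tolerance lemma, `k = 1`).

CONDITIONAL on Stein–Wuthrich 2013 Thm. 1.1, W. Zhang 2014 L8.4 (1) / 9.1, Burungale–Castella–Skinner 2025 Cor. 1.3.1, GZK by name; per curve;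
nothing class-wide (the open stub (S♭) is untouched); BSD is NOT proved by it.

References: [BurungaleCastellaSkinner2025] Cor. 1.3.1; [Darmon2004] Thm. 3.22; [SteinWuthrich2013] Thm. 1.1; [WZhang2014] L8.4 (1), Thm. 9.1,
Hypothesis ♠; [Knapp1993] Prop. 12.10; [SilvermanAEC2009] VII.5.1, VIII.8, X.4.2; [CremonaAlgorithms1997] Table 1 (563a1).
-/

set_option linter.dupNamespace false

noncomputable section

open scoped Classical NumberField

namespace Summit.BirchSwinnertonDyer.BirchSwinnertonDyer.Theorems.KolyvaginDepthDoor

open Literature.NumberTheory.EllipticCurves Literature.NumberTheory.EllipticCurves.ModularForms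
  WeierstrassCurve NumberField IsDedekindDomain
open Summit.BirchSwinnertonDyer.BirchSwinnertonDyer.Theorems
open Summit.BirchSwinnertonDyer.BirchSwinnertonDyer.Rank2Observatory
open Summit.BirchSwinnertonDyer.BirchSwinnertonDyer.Rank1Residual
open Summit.BirchSwinnertonDyer.Rank1Residual.Additive

namespace C563a1

/-- **Kodaira–Néron for `563a1` at every `p ≥ 5`**: `|Δ_min| = 563`, every exponent `< 5`. [cite: CremonaAlgorithms1997, Table 1 (563a1)] -/
theorem kodairaNeron_of_five_le (p : ℕ) (h5 : 5 ≤ p) :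
    haveI := isElliptic_c563a1;
    haveI := isGloballyMinimal_c563a1;
    ∀ v : HeightOneSpectrum (𝓞 ℚ), ((⟨1, 1, 1, -15, 16⟩ : WeierstrassCurve ℤ).map (Int.castRingHom ℚ)).HasMultiplicativeReductionAt v →
      ¬ p ∣ ((⟨1, 1, 1, -15, 16⟩ : WeierstrassCurve ℤ).map (Int.castRingHom ℚ)).ordMinimalDiscriminant v := by
  haveI := isElliptic_c563a1
  haveI := isGloballyMinimal_c563a1
  refine not_dvd_ordMinimalDiscriminant_of_intModel_table intModel (p := p) (Δ₀ := (-563)) (by decide +kernel)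
    (B := 564) (lt_of_lt_of_le (by norm_num) (Nat.pow_le_pow_right (by norm_num) h5)) ?_
  exact (by
      intro q hq hqP hqd
      have hn : ((-563 : ℤ).natAbs) = 563 ^ 1 := by norm_num
      rw [hn] at hqd ⊢
      obtain rfl := (Nat.prime_dvd_prime_iff_eq hqP (by norm_num)).mp (hqP.dvd_of_dvd_pow hqd)
      exact ⟨1, by simp, by decide +kernel, by decide +kernel, Nat.not_dvd_of_pos_of_lt (by norm_num) (by omega)⟩
      )

/-- **♠ (1) for `563a1` at every prime `p ≥ 5`** (`|Δ_min| = 563`, exponents `< 5`) **and semistability** (`gcd(c₄, Δ) = 1`).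
[cite: WZhang2014, Hypothesis ♠ (pp. 194–195)] [cite: CremonaAlgorithms1997, Table 1 (563a1)] -/
theorem spadeOne_of_five_le (p : ℕ) [hp : Fact p.Prime] (h5 : 5 ≤ p) :
    haveI := isElliptic_c563a1;
    haveI := isGloballyMinimal_c563a1;
    (∀ (ℓ : ℕ) [Fact ℓ.Prime], ((⟨1, 1, 1, -15, 16⟩ : WeierstrassCurve ℤ).map (Int.castRingHom ℚ)).HasMultiplicativeReductionAtPrime ℓ →
      ¬ p ∣ padicValInt ℓ ((⟨1, 1, 1, -15, 16⟩ : WeierstrassCurve ℤ).map (Int.castRingHom ℚ)).minimalDiscriminantInt) ∧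
      ((⟨1, 1, 1, -15, 16⟩ : WeierstrassCurve ℤ).map (Int.castRingHom ℚ)).IsSemistable ℤ := by
  haveI := isElliptic_c563a1
  haveI := isGloballyMinimal_c563a1
  have hΔ : (⟨1, 1, 1, -15, 16⟩ : WeierstrassCurve ℤ).Δ = (-563) := by decide +kernel
  refine ⟨not_dvd_padicValInt_of_intModel intModel p ?_,
    isSemistable_int_of_intModel_of_isCoprime intModel (by rw [Int.isCoprime_iff_gcd_eq_one]; decide +kernel)⟩
  rw [hΔ]
  exact (by
      intro q hqP hqd
      have hqd' : q ∣ (-563 : ℤ).natAbs := Int.natCast_dvd.mp hqd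
      have hn : ((-563 : ℤ).natAbs) = 563 ^ 1 := by norm_num
      rw [hn] at hqd'
      obtain rfl := (Nat.prime_dvd_prime_iff_eq hqP (by norm_num)).mp (hqP.dvd_of_dvd_pow hqd')
      exact ⟨1, by decide +kernel, by decide +kernel, Nat.not_dvd_of_pos_of_lt (by norm_num) (by omega)⟩
      )

/-- **`Ш(563a1/ℚ)[p] = 0` BY NAME at every admissible `5 ≤ p < 1000`** (Stein–Wuthrich 2013 Thm. 1.1: non-CM `not_hasCM`, `2 ≤ rank`
`KernelCerts001.C563a1.two_le_rank`, `N = 563 ≤ 30 000`; `p` good ordinary and `ρ̄_{E,p}` onto are hypotheses). CONDITIONAL on the named fact; per curve; BSD is not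
proved by it. [cite: SteinWuthrich2013, Thm. 1.1 (p. 1758)] -/
theorem sha_inf_torsionBy_eq_bot_at (hSW : SteinWuthrich2013_sha_inf_torsionBy_eq_bot_of_two_le_rank)
    (p : ℕ) [Fact p.Prime] (h5 : 5 ≤ p) (hp1000 : p < 1000)
    (hgood : haveI := isElliptic_c563a1; haveI := isGloballyMinimal_c563a1; ((⟨1, 1, 1, -15, 16⟩ : WeierstrassCurve ℤ).map (Int.castRingHom ℚ)).HasGoodReductionAtPrime p)
    (hord : haveI := isElliptic_c563a1; haveI := isGloballyMinimal_c563a1; ¬ (p : ℤ) ∣ ((⟨1, 1, 1, -15, 16⟩ : WeierstrassCurve ℤ).map (Int.castRingHom ℚ)).frobeniusTrace p)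
    (hsurj : haveI := isElliptic_c563a1; haveI := isGloballyMinimal_c563a1; ((⟨1, 1, 1, -15, 16⟩ : WeierstrassCurve ℤ).map (Int.castRingHom ℚ)).HasSurjectiveModNGaloisRep p) :
    haveI := isElliptic_c563a1;
    haveI := isGloballyMinimal_c563a1;
    (((⟨1, 1, 1, -15, 16⟩ : WeierstrassCurve ℤ).map (Int.castRingHom ℚ)).sha ⊓ AddSubgroup.torsionBy ((⟨1, 1, 1, -15, 16⟩ : WeierstrassCurve ℤ).map (Int.castRingHom ℚ)).galH1 (p : ℤ) : AddSubgroup _) = ⊥ := by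
  haveI := isElliptic_c563a1
  haveI := isGloballyMinimal_c563a1
  exact hSW _ not_hasCM KernelCerts001.C563a1.two_le_rank (by rw [conductorNorm_eq]; norm_num) p h5 hp1000 hgood hord hsurj

/-- **THE CRUX `KolyvaginDepthSupplyKN` AT `563a1` from ONE twist bound AT ANY ADMISSIBLE PRIME** (g17's `C389a1.cruxBody_of_twistSelmer_at`
for `563a1`): for every `5 ≤ p < 1000` with `p ∤ d_K = -8`, `p` good ordinary and `ρ_{E,p^n}` onto (hypotheses), and ONE imaginary quadratic
`K` with `d_K = -8`: IF `#Sel_p(E^{(d_K)}/ℚ) ≤ p²` THEN the clause of the crux holds at `W = 563a1` verbatim (`cruxBody_of_sha_of_twistSelmer_of_lemma84`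
with `Ш(E)[p] = 0` from SW Thm. 1.1; `p² ≤ p^rank` by `KernelCerts001.C563a1.two_le_rank`). CONDITIONAL on W. Zhang L8.4 (1) / 9.1 and SW Thm. 1.1 by name, and the one
twist datum; per curve; BSD is not proved by it. [cite: SteinWuthrich2013, Thm. 1.1 (p. 1758)] [cite: WZhang2014, Lemma 8.4 (1) (p. 236), Thm. 9.1 (p. 240)] -/
theorem cruxBody_of_twistSelmer_at
    (hSW : SteinWuthrich2013_sha_inf_torsionBy_eq_bot_of_two_le_rank)
    (h84 : Literature.NumberTheory.EllipticCurves.WZhang2014_lemma84_exists_minimal_kolyvaginClass_one_selmerCard)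
    (p : ℕ) [hp : Fact p.Prime] (h5 : 5 ≤ p) (hp1000 : p < 1000)
    (hgood : haveI := isElliptic_c563a1; haveI := isGloballyMinimal_c563a1; ((⟨1, 1, 1, -15, 16⟩ : WeierstrassCurve ℤ).map (Int.castRingHom ℚ)).HasGoodReductionAtPrime p)
    (hord : haveI := isElliptic_c563a1; haveI := isGloballyMinimal_c563a1; ¬ (p : ℤ) ∣ ((⟨1, 1, 1, -15, 16⟩ : WeierstrassCurve ℤ).map (Int.castRingHom ℚ)).frobeniusTrace p)
    (htower : haveI := isElliptic_c563a1; haveI := isGloballyMinimal_c563a1; ∀ n : ℕ, ((⟨1, 1, 1, -15, 16⟩ : WeierstrassCurve ℤ).map (Int.castRingHom ℚ)).HasSurjectiveModNGaloisRep (p ^ n : ℕ))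
    (K : Type) [Field K] [NumberField K] (hK : IsImaginaryQuadratic K) (hD : NumberField.discr K = -8)
    (hT : haveI := isElliptic_c563a1; haveI := isGloballyMinimal_c563a1; Nat.card ((((⟨1, 1, 1, -15, 16⟩ : WeierstrassCurve ℤ).map (Int.castRingHom ℚ)).quadraticTwist (NumberField.discr K : ℚ)).selmerGroup p) ≤ p ^ 2) :
    haveI := isElliptic_c563a1;
    haveI := isGloballyMinimal_c563a1;
    ∃ (p : ℕ) (hp : Fact p.Prime), 5 ≤ p ∧ ((⟨1, 1, 1, -15, 16⟩ : WeierstrassCurve ℤ).map (Int.castRingHom ℚ)).HasGoodReductionAtPrime p ∧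
      ¬ (p : ℤ) ∣ ((⟨1, 1, 1, -15, 16⟩ : WeierstrassCurve ℤ).map (Int.castRingHom ℚ)).frobeniusTrace p ∧ (∀ n : ℕ, ((⟨1, 1, 1, -15, 16⟩ : WeierstrassCurve ℤ).map (Int.castRingHom ℚ)).HasSurjectiveModNGaloisRep (p ^ n : ℕ)) ∧
      (∀ v : HeightOneSpectrum (𝓞 ℚ), ((⟨1, 1, 1, -15, 16⟩ : WeierstrassCurve ℤ).map (Int.castRingHom ℚ)).HasMultiplicativeReductionAt v →
        ¬ p ∣ ((⟨1, 1, 1, -15, 16⟩ : WeierstrassCurve ℤ).map (Int.castRingHom ℚ)).ordMinimalDiscriminant v) ∧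
      ∃ (K : Type) (_ : Field K) (_ : NumberField K), IsImaginaryQuadratic K ∧
        NumberField.discr K ≠ -3 ∧ NumberField.discr K ≠ -4 ∧
        ∃ (_ : NeZero (((⟨1, 1, 1, -15, 16⟩ : WeierstrassCurve ℤ).map (Int.castRingHom ℚ)).conductorNorm ℤ)), SatisfiesHeegnerHypothesis (((⟨1, 1, 1, -15, 16⟩ : WeierstrassCurve ℤ).map (Int.castRingHom ℚ)).conductorNorm ℤ) K ∧
        ∃ (Dt : ModularParametrizationData ((⟨1, 1, 1, -15, 16⟩ : WeierstrassCurve ℤ).map (Int.castRingHom ℚ)) (((⟨1, 1, 1, -15, 16⟩ : WeierstrassCurve ℤ).map (Int.castRingHom ℚ)).conductorNorm ℤ)) (β : ℤ) (ι : K →+* ℂ) (n₁ : ℕ)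
          (d : KolyvaginHeegnerData Dt β ι n₁), Squarefree n₁ ∧
          (∀ q ∈ n₁.primeFactors, Zhang2014.IsKolyvaginPrime (((⟨1, 1, 1, -15, 16⟩ : WeierstrassCurve ℤ).map (Int.castRingHom ℚ)).conductorNorm ℤ) ((⟨1, 1, 1, -15, 16⟩ : WeierstrassCurve ℤ).map (Int.castRingHom ℚ)) K p q) ∧
          d.kolyvaginClass hp.out 1 ≠ 0 ∧
          (n₁.primeFactors.card + 1 ≤ ((⟨1, 1, 1, -15, 16⟩ : WeierstrassCurve ℤ).map (Int.castRingHom ℚ)).mordellWeilRank ∨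
            (n₁.primeFactors.card ≤ ((⟨1, 1, 1, -15, 16⟩ : WeierstrassCurve ℤ).map (Int.castRingHom ℚ)).mordellWeilRank ∧
              n₁.primeFactors.card + 1 ≤ (((⟨1, 1, 1, -15, 16⟩ : WeierstrassCurve ℤ).map (Int.castRingHom ℚ)).quadraticTwist (NumberField.discr K : ℚ)).mordellWeilRank)) := by
  haveI := isElliptic_c563a1
  haveI := isGloballyMinimal_c563a1
  haveI iNZ : NeZero (((⟨1, 1, 1, -15, 16⟩ : WeierstrassCurve ℤ).map (Int.castRingHom ℚ)).conductorNorm ℤ) := neZero_conductorNorm_of_isElliptic _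
  have hsp := spadeOne_of_five_le p h5
  have hH := satisfiesHeegnerHypothesis_conductorNorm_of_intModel intModel K hK.1 hD heegner_neg8
  have hS2 : ¬ Squarefree (((⟨1, 1, 1, -15, 16⟩ : WeierstrassCurve ℤ).map (Int.castRingHom ℚ)).conductorNorm ℤ) →
      (∃ (ℓ : ℕ) (_ : Fact ℓ.Prime), ((⟨1, 1, 1, -15, 16⟩ : WeierstrassCurve ℤ).map (Int.castRingHom ℚ)).HasMultiplicativeReductionAtPrime ℓ ∧
          ¬ p ∣ padicValInt ℓ ((⟨1, 1, 1, -15, 16⟩ : WeierstrassCurve ℤ).map (Int.castRingHom ℚ)).minimalDiscriminantInt) ∧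
        ∃ (ℓ₁ ℓ₂ : ℕ) (_ : Fact ℓ₁.Prime) (_ : Fact ℓ₂.Prime), ℓ₁ ≠ ℓ₂ ∧
          ((⟨1, 1, 1, -15, 16⟩ : WeierstrassCurve ℤ).map (Int.castRingHom ℚ)).HasMultiplicativeReductionAtPrime ℓ₁ ∧ ((⟨1, 1, 1, -15, 16⟩ : WeierstrassCurve ℤ).map (Int.castRingHom ℚ)).HasMultiplicativeReductionAtPrime ℓ₂ :=
    fun hns ↦ absurd ((((⟨1, 1, 1, -15, 16⟩ : WeierstrassCurve ℤ).map (Int.castRingHom ℚ))).isSemistable_iff_squarefree_conductorNorm.mp hsp.2) hns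
  have hD3 : NumberField.discr K ≠ -3 := by rw [hD]; norm_num
  have hD4 : NumberField.discr K ≠ -4 := by rw [hD]; norm_num
  have hpD : ¬ ((p : ℤ) ∣ NumberField.discr K) := by
    rw [hD]
    intro h
    have h' : p ∣ (-8 : ℤ).natAbs := Int.natCast_dvd.mp (by simpa using h)
    have hpP' : p.Prime := hp.out
    have hn : ((-8 : ℤ).natAbs) = 2 ^ 3 := by norm_num
    rw [hn] at h'
    have := (Nat.prime_dvd_prime_iff_eq hpP' (by norm_num)).mp (hpP'.dvd_of_dvd_pow h')
    omega
  have hsur : ((⟨1, 1, 1, -15, 16⟩ : WeierstrassCurve ℤ).map (Int.castRingHom ℚ)).HasSurjectiveModNGaloisRep p := by simpa only [pow_one] using htower 1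
  have hT' : Nat.card ((((⟨1, 1, 1, -15, 16⟩ : WeierstrassCurve ℤ).map (Int.castRingHom ℚ)).quadraticTwist (NumberField.discr K : ℚ)).selmerGroup p) ≤ p ^ ((⟨1, 1, 1, -15, 16⟩ : WeierstrassCurve ℤ).map (Int.castRingHom ℚ)).mordellWeilRank :=
    hT.trans (Nat.pow_le_pow_right hp.out.pos KernelCerts001.C563a1.two_le_rank)
  exact cruxBody_of_sha_of_twistSelmer_of_lemma84 h84 _ KernelCerts001.C563a1.two_le_rank p h5 hgood hord htower
    (kodairaNeron_of_five_le p h5) hsp.1 hS2 K hK hD3 hD4 hpD hH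
    (sha_inf_torsionBy_eq_bot_at hSW p h5 hp1000 hgood hord hsur) hT'

/-- **Kodaira–Néron for the twist model `T₀ = [0, -1, 0, -961, -11167]` at EVERY `p ≥ 5`**: `Δ(T₀) = 2^18 · 563`; the places above the primes of `d_K` are ADDITIVE
(`q ∣ c₄(T₀) = 46144`), the other exponents are `< 5` (additive-aware table lemma, `B = 564`, `|Δ| < 564⁵ ≤ 564^p`).
[cite: SilvermanAEC2009, VII.5 Prop. 5.1 (c), VIII.8] -/
theorem minTwist8_kodairaNeron_of_five_le (p : ℕ) (h5 : 5 ≤ p) :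
    haveI := minTwist8_isElliptic; haveI := minTwist8_isGloballyMinimal;
    ∀ v : HeightOneSpectrum (𝓞 ℚ),
      ((⟨0, -1, 0, -961, -11167⟩ : WeierstrassCurve ℤ).map (Int.castRingHom ℚ)).HasMultiplicativeReductionAt v →
      ¬ p ∣ ((⟨0, -1, 0, -961, -11167⟩ : WeierstrassCurve ℤ).map (Int.castRingHom ℚ)).ordMinimalDiscriminant v := by
  haveI := minTwist8_isElliptic
  haveI := minTwist8_isGloballyMinimal
  refine not_dvd_ordMinimalDiscriminant_of_intModel_table_additive minTwist8_intModel (p := p) (Δ₀ := (-147587072))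
    (c₀ := 46144) (by decide +kernel) (by decide +kernel) (B := 564)
    (lt_of_lt_of_le (by norm_num) (Nat.pow_le_pow_right (by norm_num) h5)) ?_
  exact (by
      intro q hq hqP hqd
      have hn : ((-147587072 : ℤ).natAbs) = 2 ^ 18 * (563 ^ 1) := by norm_num
      rw [hn] at hqd ⊢
      rcases (Nat.Prime.dvd_mul hqP).mp hqd with h | h0
      · obtain rfl := (Nat.prime_dvd_prime_iff_eq hqP (by norm_num)).mp (hqP.dvd_of_dvd_pow h)
        exact Or.inl (by norm_num)
      · obtain rfl := (Nat.prime_dvd_prime_iff_eq hqP (by norm_num)).mp (hqP.dvd_of_dvd_pow h0)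
        exact Or.inr ⟨1, by simp, by decide +kernel, by decide +kernel, Nat.not_dvd_of_pos_of_lt (by norm_num) (by omega)⟩
      )

/-- **THE CRUX `KolyvaginDepthSupplyKN` AT `563a1` FROM ONE BSD-QUOTIENT VALUATION AT ANY ADMISSIBLE PRIME (`E`-sided hypotheses,
tolerance `1`).** For every `5 ≤ p < 1000` with `p ∤ d_K`, `563a1` good ordinary at `p` and `ρ_{E,p^n}` onto, ONE `K` with `d_K = -8`, and the
minimal model `T₀ = [0, -1, 0, -961, -11167]` of `E^{(-8)}`: IF `ord_{s=1} L(T₀,s) = 1` and `ord_p(L'(T₀,1)/(Ω_{T₀}·Reg_{T₀})) ≤ 1`, THEN the clause of the crux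
holds at `563a1` VERBATIM. `ρ̄_{T,p}` onto, good reduction and ordinarity of `T₀` at `p` are DERIVED from `E`
(`hasSurjectiveModNGaloisRep_of_smul_eq_quadraticTwist`, `goodOrdinary_of_smul_eq_quadraticTwist`); `#Sel_p(T₀) ≤ p²` by
`natCard_selmerGroup_le_pow_succ_of_rankOne_bsdQuotient_bcs` (`k = 1`); transport along `minTwist8_smul_eq`; then `cruxBody_of_twistSelmer_at`.
CONDITIONAL on SW Thm. 1.1, W. Zhang L8.4 (1) / 9.1, BCS 2025 Cor. 1.3.1, GZK by name; per curve; BSD is not proved by it.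
[cite: BurungaleCastellaSkinner2025, Cor. 1.3.1 (p. 4)] [cite: Darmon2004, Thm. 3.22] [cite: SteinWuthrich2013, Thm. 1.1 (p. 1758)]
[cite: WZhang2014, Lemma 8.4 (1) (p. 236), Thm. 9.1 (p. 240)] [cite: Knapp1993, Prop. 12.10] -/
theorem cruxBody_of_twistBSDQuotient_at
    (hSW : SteinWuthrich2013_sha_inf_torsionBy_eq_bot_of_two_le_rank)
    (h84 : Literature.NumberTheory.EllipticCurves.WZhang2014_lemma84_exists_minimal_kolyvaginClass_one_selmerCard)
    (hBCS : BurungaleCastellaSkinner2025.cor131_padicValRat_bsd_rank_le_one)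
    (hGZK : rank_eq_analyticRank_of_analyticRank_le_one)
    (p : ℕ) [hp : Fact p.Prime] (h5 : 5 ≤ p) (hp1000 : p < 1000)
    (hgood : haveI := isElliptic_c563a1; haveI := isGloballyMinimal_c563a1; ((⟨1, 1, 1, -15, 16⟩ : WeierstrassCurve ℤ).map (Int.castRingHom ℚ)).HasGoodReductionAtPrime p)
    (hord : haveI := isElliptic_c563a1; haveI := isGloballyMinimal_c563a1; ¬ (p : ℤ) ∣ ((⟨1, 1, 1, -15, 16⟩ : WeierstrassCurve ℤ).map (Int.castRingHom ℚ)).frobeniusTrace p)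
    (htower : haveI := isElliptic_c563a1; haveI := isGloballyMinimal_c563a1; ∀ n : ℕ, ((⟨1, 1, 1, -15, 16⟩ : WeierstrassCurve ℤ).map (Int.castRingHom ℚ)).HasSurjectiveModNGaloisRep (p ^ n : ℕ))
    (K : Type) [Field K] [NumberField K] (hK : IsImaginaryQuadratic K) (hD : NumberField.discr K = -8)
    (hr : haveI := minTwist8_isElliptic;
      ((⟨0, -1, 0, -961, -11167⟩ : WeierstrassCurve ℤ).map (Int.castRingHom ℚ)).analyticRank = 1)
    (hval : haveI := minTwist8_isElliptic; haveI := minTwist8_isGloballyMinimal;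
      ∀ q : ℚ, ((⟨0, -1, 0, -961, -11167⟩ : WeierstrassCurve ℤ).map (Int.castRingHom ℚ)).leadingLCoeff /
          (((((⟨0, -1, 0, -961, -11167⟩ : WeierstrassCurve ℤ).map (Int.castRingHom ℚ)).realPeriodRat *
              ((⟨0, -1, 0, -961, -11167⟩ : WeierstrassCurve ℤ).map (Int.castRingHom ℚ)).regulator : ℝ)) : ℂ) = (q : ℂ) →
        padicValRat p q ≤ 1) :
    haveI := isElliptic_c563a1;
    haveI := isGloballyMinimal_c563a1;
    ∃ (p : ℕ) (hp : Fact p.Prime), 5 ≤ p ∧ ((⟨1, 1, 1, -15, 16⟩ : WeierstrassCurve ℤ).map (Int.castRingHom ℚ)).HasGoodReductionAtPrime p ∧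
      ¬ (p : ℤ) ∣ ((⟨1, 1, 1, -15, 16⟩ : WeierstrassCurve ℤ).map (Int.castRingHom ℚ)).frobeniusTrace p ∧ (∀ n : ℕ, ((⟨1, 1, 1, -15, 16⟩ : WeierstrassCurve ℤ).map (Int.castRingHom ℚ)).HasSurjectiveModNGaloisRep (p ^ n : ℕ)) ∧
      (∀ v : HeightOneSpectrum (𝓞 ℚ), ((⟨1, 1, 1, -15, 16⟩ : WeierstrassCurve ℤ).map (Int.castRingHom ℚ)).HasMultiplicativeReductionAt v →
        ¬ p ∣ ((⟨1, 1, 1, -15, 16⟩ : WeierstrassCurve ℤ).map (Int.castRingHom ℚ)).ordMinimalDiscriminant v) ∧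
      ∃ (K : Type) (_ : Field K) (_ : NumberField K), IsImaginaryQuadratic K ∧
        NumberField.discr K ≠ -3 ∧ NumberField.discr K ≠ -4 ∧
        ∃ (_ : NeZero (((⟨1, 1, 1, -15, 16⟩ : WeierstrassCurve ℤ).map (Int.castRingHom ℚ)).conductorNorm ℤ)), SatisfiesHeegnerHypothesis (((⟨1, 1, 1, -15, 16⟩ : WeierstrassCurve ℤ).map (Int.castRingHom ℚ)).conductorNorm ℤ) K ∧
        ∃ (Dt : ModularParametrizationData ((⟨1, 1, 1, -15, 16⟩ : WeierstrassCurve ℤ).map (Int.castRingHom ℚ)) (((⟨1, 1, 1, -15, 16⟩ : WeierstrassCurve ℤ).map (Int.castRingHom ℚ)).conductorNorm ℤ)) (β : ℤ) (ι : K →+* ℂ) (n₁ : ℕ)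
          (d : KolyvaginHeegnerData Dt β ι n₁), Squarefree n₁ ∧
          (∀ q ∈ n₁.primeFactors, Zhang2014.IsKolyvaginPrime (((⟨1, 1, 1, -15, 16⟩ : WeierstrassCurve ℤ).map (Int.castRingHom ℚ)).conductorNorm ℤ) ((⟨1, 1, 1, -15, 16⟩ : WeierstrassCurve ℤ).map (Int.castRingHom ℚ)) K p q) ∧
          d.kolyvaginClass hp.out 1 ≠ 0 ∧
          (n₁.primeFactors.card + 1 ≤ ((⟨1, 1, 1, -15, 16⟩ : WeierstrassCurve ℤ).map (Int.castRingHom ℚ)).mordellWeilRank ∨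
            (n₁.primeFactors.card ≤ ((⟨1, 1, 1, -15, 16⟩ : WeierstrassCurve ℤ).map (Int.castRingHom ℚ)).mordellWeilRank ∧
              n₁.primeFactors.card + 1 ≤ (((⟨1, 1, 1, -15, 16⟩ : WeierstrassCurve ℤ).map (Int.castRingHom ℚ)).quadraticTwist (NumberField.discr K : ℚ)).mordellWeilRank)) := by
  haveI := isElliptic_c563a1
  haveI := isGloballyMinimal_c563a1
  haveI iT := minTwist8_isElliptic
  haveI := minTwist8_isGloballyMinimal
  have hpP : p.Prime := hp.out
  have hsurE : ((⟨1, 1, 1, -15, 16⟩ : WeierstrassCurve ℤ).map (Int.castRingHom ℚ)).HasSurjectiveModNGaloisRep p := by simpa only [pow_one] using htower 1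
  have hTsur : ((⟨0, -1, 0, -961, -11167⟩ : WeierstrassCurve ℤ).map (Int.castRingHom ℚ)).HasSurjectiveModNGaloisRep p :=
    hasSurjectiveModNGaloisRep_of_smul_eq_quadraticTwist ((⟨1, 1, 1, -15, 16⟩ : WeierstrassCurve ℤ).map (Int.castRingHom ℚ)) _ (by norm_num : ((-8) : ℚ) ≠ 0) minTwist8_smul_eq p hsurE
  have hp2d : ¬ ((p : ℤ) ∣ 2 * (-2 : ℤ)) := by
    intro h
    rcases (Nat.prime_iff_prime_int.mp hpP).dvd_or_dvd h with h2 | h2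
    · have : p = 2 := (Nat.prime_dvd_prime_iff_eq hpP Nat.prime_two).mp (by exact_mod_cast h2)
      omega
    · have h' : p ∣ (-2 : ℤ).natAbs := Int.natCast_dvd.mp (by simpa using h2)
      have hpP' : p.Prime := hpP
      have hn : ((-2 : ℤ).natAbs) = 2 ^ 1 := by norm_num
      rw [hn] at h'
      have := (Nat.prime_dvd_prime_iff_eq hpP' (by norm_num)).mp (hpP'.dvd_of_dvd_pow h')
      omega
  -- `E^(-8) ≅ E^(-2)` over `ℚ` (square factor): the twisting formula applies with the square-free `d = -2`
  obtain ⟨C₂, hC₂⟩ := (((⟨1, 1, 1, -15, 16⟩ : WeierstrassCurve ℤ).map (Int.castRingHom ℚ))).exists_variableChange_quadraticTwist_mul_sq ((-2 : ℤ) : ℚ) (2 : ℚ) (by norm_num)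
  have hC₂' : C₂ • ((⟨1, 1, 1, -15, 16⟩ : WeierstrassCurve ℤ).map (Int.castRingHom ℚ)).quadraticTwist ((-2 : ℤ) : ℚ) = ((⟨1, 1, 1, -15, 16⟩ : WeierstrassCurve ℤ).map (Int.castRingHom ℚ)).quadraticTwist ((-8) : ℚ) := by
    rw [hC₂]; norm_num
  have hC' : (C₂⁻¹ * (⟨1, (-3 : ℚ), (0 : ℚ), (0 : ℚ)⟩ : WeierstrassCurve.VariableChange ℚ)) • ((⟨0, -1, 0, -961, -11167⟩ : WeierstrassCurve ℤ).map (Int.castRingHom ℚ)) = ((⟨1, 1, 1, -15, 16⟩ : WeierstrassCurve ℤ).map (Int.castRingHom ℚ)).quadraticTwist ((-2 : ℤ) : ℚ) := by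
    rw [mul_smul, minTwist8_smul_eq, ← hC₂', inv_smul_smul]
  obtain ⟨hTgood, hTord⟩ := goodOrdinary_of_smul_eq_quadraticTwist ((⟨1, 1, 1, -15, 16⟩ : WeierstrassCurve ℤ).map (Int.castRingHom ℚ)) ((⟨0, -1, 0, -961, -11167⟩ : WeierstrassCurve ℤ).map (Int.castRingHom ℚ)) (d := -2)
    (by rw [← Int.squarefree_natAbs]; exact (Nat.prime_iff.mp (by norm_num : Nat.Prime 2)).squarefree) hC' p hp2d hgood hord
  have hSelT : Nat.card (((⟨0, -1, 0, -961, -11167⟩ : WeierstrassCurve ℤ).map (Int.castRingHom ℚ)).selmerGroup p) ≤ p ^ (1 + 1) :=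
    natCard_selmerGroup_le_pow_succ_of_rankOne_bsdQuotient_bcs hBCS hGZK _ p h5 minTwist8_not_hasCM hTgood hTord hTsur
      (minTwist8_kodairaNeron_of_five_le p h5) hr 1 hval
  have hSel : Nat.card ((((⟨1, 1, 1, -15, 16⟩ : WeierstrassCurve ℤ).map (Int.castRingHom ℚ)).quadraticTwist (NumberField.discr K : ℚ)).selmerGroup p) ≤ p ^ 2 := by
    have hcast : (NumberField.discr K : ℚ) = ((-8) : ℚ) := by rw [hD]; norm_num
    rw [hcast, ← natCard_selmerGroup_eq_of_variableChange (p : ℤ) minTwist8_smul_eq]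
    exact hSelT
  exact cruxBody_of_twistSelmer_at hSW h84 p h5 hp1000  hgood hord htower K hK hD hSel

end C563a1

end Summit.BirchSwinnertonDyer.BirchSwinnertonDyer.Theorems.KolyvaginDepthDoor

end
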